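import Literature.AlgebraicGeometry.Motives.HodgeLieWeightOneRaisingCentralizer
import HarnessLib

/-!
# Weight one, `2 · rank B > dim V^{1,0}`: the raising space is a RANK-ONE Jordan triple — `B + y` has rank `rank B` for every
# Peirce-`1` element `y` (Moonen–Zarhin 1999 (2.3); Loos' Peirce calculus)

Family `hodge`, layer `Literature/AlgebraicGeometry/Motives`; THEOREMS ONLY (no definition, no named fact; D-0026).  Written for the
cell `pub-hodgeav-hg6` (LADDER-HodgeAV row 2, TABLE X row 1 `g6.I(1)`: brick N14 of the row-1 programme, first step of the successor
plan (4)(a) of HANDOFF § eng-2 g4 for the case `r = 4`, `dim V^{1,0} = 6`; honest framing: HC / HC_AV / HC_CM NOT proved —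
unconditional Hodge–Lie linear algebra).

SETTING as in `HodgeLieWeightOnePeirceTwo` (N7): `B ∈ 𝔊` a minimal raising tripotent (`B C B = t B`, `E = t⁻¹ B C`, `F = t⁻¹ C B`)
with `2 · rank B > dim V^{1,0}`, so that the Peirce-`0` space vanishes and every raising `x ∈ 𝔊` is `s B + x₁`.

* **`WeightOnePeirce.mul_conjOp_mul_eq_zero_of_peirceOne`** — for a raising `y ∈ 𝔊` with `E y F = 0` (no Peirce-`2` component):
  `y C y = 0` (it equals `½[[y, C], y] ∈ 𝔊` and is its own Peirce-`0` component).
* **`WeightOnePeirce.finrank_range_add_peirceOne`** — `rank (B + y) = rank B`: `range (B + y) = (B + y)(range F)` (for `q ∈ Q`,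
  `(B + y)((1 − F) q) = (E y) q = (B + y)(t⁻¹ C (E y q))` because `(y F) C (E y) = y C y = 0` and `B C (E y) = t E y`), and
  `dim (B + y)(range F) ≤ dim range F ≤ rank B ≤ rank (B + y)` by minimality.  Consequently (with N7) every raising element of `𝔊`
  with a non-zero Peirce-`2` component has rank exactly `rank B`: for `2 · rank B > dim V^{1,0}` the raising space is a rank-one Jordan
  triple all of whose elements off the Peirce-`1` hyperplane are minimal tripotents (**`…finrank_range_eq_of_peirceTwo_ne_zero`**).

## References

* [MoonenZarhin1999LowDim] B. Moonen, Yu. Zarhin, *Hodge classes on abelian varieties of low dimension*, Math. Ann. 315 (1999),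
  §2 (2.3)–(2.5).
* [Deligne1982HodgeCycles] P. Deligne, *Hodge cycles on abelian varieties*, LNM 900 (1982), I §3 (Prop. 3.4, 3.6).
* O. Loos, *Bounded symmetric domains and Jordan pairs* (Irvine 1977), §3 (Peirce decomposition; terminology only, not a cite key).
-/

noncomputable section

open scoped TensorProduct

namespace Literature.AlgebraicGeometry.Motives

namespace HodgeStructure

universe u

variable {V : Type u} [AddCommGroup V] [Module ℚ V] [Module.Finite ℚ V] [HodgeTensorFacts.{u, u}] {n : ℤ}

set_option maxHeartbeats 1600000 in
/-- **`y C y = 0` for a Peirce-`1` raising `y`** when `2 · rank B > dim V^{1,0}` (the Peirce-`0` space vanishes, N7).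
[cite: MoonenZarhin1999LowDim, §2 (2.3)–(2.5)] [cite: Deligne1982HodgeCycles, I §3 Prop. 3.4, Prop. 3.6] -/
theorem WeightOnePeirce.mul_conjOp_mul_eq_zero_of_peirceOne (H : HodgeStructure V n) (ψ : H.Polarization) (hn : n = 1)
    (heff : H.IsEffective) {Θ : Module.End ℂ (ℂ ⊗[ℚ] V)} (hΘ : ∀ p, ∀ x ∈ H.piece p (n - p), Θ x = ((2 * p - n : ℤ) : ℂ) • x)
    {𝔊 : Submodule ℂ (Module.End ℂ (ℂ ⊗[ℚ] V))} (h𝔊 : 𝔊 ≤ H.hodgeLieC) (hbr : ∀ Y ∈ 𝔊, ∀ Z ∈ 𝔊, Y * Z - Z * Y ∈ 𝔊)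
    {B C : Module.End ℂ (ℂ ⊗[ℚ] V)} (hB : B ∈ 𝔊) (hB0 : B ≠ 0) (hBP : ∀ p ∈ H.piece 1 0, B p = 0)
    (hBim : ∀ v, B v ∈ H.piece 1 0) (hC : ∀ v, C v = conj (B (conj v))) (hC𝔊 : C ∈ 𝔊)
    (hmin : ∀ B' ∈ 𝔊, B' ≠ 0 → (∀ p ∈ H.piece 1 0, B' p = 0) → (∀ v, B' v ∈ H.piece 1 0) →
      Module.finrank ℂ (LinearMap.range B) ≤ Module.finrank ℂ (LinearMap.range B'))
    {t : ℂ} (ht : t ≠ 0) (hBCB : B * C * B = t • B)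
    (h2r : Module.finrank ℂ (H.piece 1 0) < 2 * Module.finrank ℂ (LinearMap.range B))
    {y : Module.End ℂ (ℂ ⊗[ℚ] V)} (hy : y ∈ 𝔊) (hyP : ∀ p ∈ H.piece 1 0, y p = 0) (hyim : ∀ v, y v ∈ H.piece 1 0)
    (hEyF : t⁻¹ • (B * C) * y * (t⁻¹ • (C * B)) = 0) : y * C * y = 0 := by
  classical
  obtain ⟨hCBC, -⟩ := WeightOnePeirce.conjOp_mul_conjOp_mul hC ht hB0 hBCB
  subst hn
  obtain ⟨hCQ, hCim, -, -⟩ := SymplecticThetaTen.conjOp_raise (P := H.piece 1 0) (Q := H.piece 0 1)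
    (fun x hx => conj_mem_piece H hx) (fun x hx => conj_mem_piece H hx) hBP hBim hC
  have hBB : B * B = 0 := LinearMap.ext fun v => by
    rw [Module.End.mul_apply, hBP _ (hBim v), LinearMap.zero_apply]
  have hCC : C * C = 0 := LinearMap.ext fun v => by
    rw [Module.End.mul_apply, hCQ _ (hCim v), LinearMap.zero_apply]
  have hyy : y * y = 0 := LinearMap.ext fun v => by
    rw [Module.End.mul_apply, hyP _ (hyim v), LinearMap.zero_apply]
  obtain ⟨E, hE⟩ : ∃ E : Module.End ℂ (ℂ ⊗[ℚ] V), E = t⁻¹ • (B * C) := ⟨_, rfl⟩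
  obtain ⟨F, hF⟩ : ∃ F : Module.End ℂ (ℂ ⊗[ℚ] V), F = t⁻¹ • (C * B) := ⟨_, rfl⟩
  rw [← hE, ← hF] at hEyF
  obtain ⟨hEE, hFF, hEB, hBF, hFC, hCE, hBE, hFB, hEF, hFE⟩ := WeightOnePeirce.tripotent_facts ht hBCB hCBC hBB hCC hE hF
  -- `y C y = ½ [[y, C], y] ∈ 𝔊`, raising
  have hyCy𝔊 : y * C * y ∈ 𝔊 := by
    have h1 : y * C - C * y ∈ 𝔊 := hbr y hy C hC𝔊
    have h2 : (y * C - C * y) * y - y * (y * C - C * y) ∈ 𝔊 := hbr _ h1 y hy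
    have h3 : (y * C - C * y) * y - y * (y * C - C * y) = (2 : ℂ) • (y * C * y) := by
      rw [sub_mul, mul_sub, show C * y * y = 0 by rw [mul_assoc, hyy, mul_zero],
        show y * (y * C) = 0 by rw [← mul_assoc, hyy, zero_mul], show y * (C * y) = y * C * y by rw [mul_assoc], two_smul]
      abel
    rw [h3] at h2
    have h4 := Submodule.smul_mem 𝔊 (2 : ℂ)⁻¹ h2
    rwa [smul_smul, inv_mul_cancel₀ (two_ne_zero' ℂ), one_smul] at h4
  have hyCyP : ∀ p ∈ H.piece 1 0, (y * C * y) p = 0 := fun p hp => by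
    rw [Module.End.mul_apply, Module.End.mul_apply, hyP p hp, map_zero, map_zero]
  have hyCyim : ∀ v, (y * C * y) v ∈ H.piece 1 0 := fun v => by
    rw [Module.End.mul_apply, Module.End.mul_apply]
    exact hyim _
  -- `y C y` is its own Peirce-0 component: `E (y C y) = 0`, `(y C y) F = 0`
  have ha : E * y * C = 0 := by
    conv_lhs => rw [← hFC]
    rw [← mul_assoc, hEyF, zero_mul]
  have ha' : C * (y * F) = 0 := by
    -- `y F` takes values in `ker E`, and `C = C E`
    have h1 : E * (y * F) = 0 := by rw [← mul_assoc, hEyF]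
    rw [← hCE, mul_assoc, h1, mul_zero]
  have hE0 : E * (y * C * y) = 0 := by rw [← mul_assoc, ← mul_assoc, ha, zero_mul]
  have hF0 : y * C * y * F = 0 := by rw [mul_assoc (y * C) y F, mul_assoc y C (y * F), ha', mul_zero]
  have h := WeightOnePeirce.peirceZero_eq_zero H ψ rfl heff hΘ h𝔊 hbr hB hB0 hBP hBim hC hC𝔊 hmin ht hBCB h2r hyCy𝔊 hyCyP
    hyCyim
  rw [← hE, ← hF, hE0, hF0, zero_mul, sub_zero, sub_zero, add_zero] at h
  exact h

set_option maxHeartbeats 1600000 in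
/-- **`rank (B + y) = rank B` for a Peirce-`1` raising `y`** when `2 · rank B > dim V^{1,0}`: the raising space is a rank-one Jordan
triple. [cite: MoonenZarhin1999LowDim, §2 (2.3)–(2.5)] [cite: Deligne1982HodgeCycles, I §3 Prop. 3.4, Prop. 3.6] -/
theorem WeightOnePeirce.finrank_range_add_peirceOne (H : HodgeStructure V n) (ψ : H.Polarization) (hn : n = 1)
    (heff : H.IsEffective) {Θ : Module.End ℂ (ℂ ⊗[ℚ] V)} (hΘ : ∀ p, ∀ x ∈ H.piece p (n - p), Θ x = ((2 * p - n : ℤ) : ℂ) • x)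
    {𝔊 : Submodule ℂ (Module.End ℂ (ℂ ⊗[ℚ] V))} (h𝔊 : 𝔊 ≤ H.hodgeLieC) (hbr : ∀ Y ∈ 𝔊, ∀ Z ∈ 𝔊, Y * Z - Z * Y ∈ 𝔊)
    {B C : Module.End ℂ (ℂ ⊗[ℚ] V)} (hB : B ∈ 𝔊) (hB0 : B ≠ 0) (hBP : ∀ p ∈ H.piece 1 0, B p = 0)
    (hBim : ∀ v, B v ∈ H.piece 1 0) (hC : ∀ v, C v = conj (B (conj v))) (hC𝔊 : C ∈ 𝔊)
    (hmin : ∀ B' ∈ 𝔊, B' ≠ 0 → (∀ p ∈ H.piece 1 0, B' p = 0) → (∀ v, B' v ∈ H.piece 1 0) →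
      Module.finrank ℂ (LinearMap.range B) ≤ Module.finrank ℂ (LinearMap.range B'))
    {t : ℂ} (ht : t ≠ 0) (hBCB : B * C * B = t • B)
    (h2r : Module.finrank ℂ (H.piece 1 0) < 2 * Module.finrank ℂ (LinearMap.range B))
    {y : Module.End ℂ (ℂ ⊗[ℚ] V)} (hy : y ∈ 𝔊) (hyP : ∀ p ∈ H.piece 1 0, y p = 0) (hyim : ∀ v, y v ∈ H.piece 1 0)
    (hy1 : t⁻¹ • (B * C) * y + y * (t⁻¹ • (C * B)) = y) (hEyF : t⁻¹ • (B * C) * y * (t⁻¹ • (C * B)) = 0) :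
    Module.finrank ℂ (LinearMap.range (B + y)) = Module.finrank ℂ (LinearMap.range B) := by
  classical
  have hyCy := WeightOnePeirce.mul_conjOp_mul_eq_zero_of_peirceOne H ψ hn heff hΘ h𝔊 hbr hB hB0 hBP hBim hC hC𝔊 hmin ht hBCB
    h2r hy hyP hyim hEyF
  obtain ⟨hCBC, -⟩ := WeightOnePeirce.conjOp_mul_conjOp_mul hC ht hB0 hBCB
  subst hn
  obtain ⟨hPmem, hQmem, hΘ10, hΘ01, -⟩ := UnitaryTheta.theta_facts H rfl heff hΘ
  obtain ⟨hCQ, hCim, -, -⟩ := SymplecticThetaTen.conjOp_raise (P := H.piece 1 0) (Q := H.piece 0 1)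
    (fun x hx => conj_mem_piece H hx) (fun x hx => conj_mem_piece H hx) hBP hBim hC
  have hBB : B * B = 0 := LinearMap.ext fun v => by
    rw [Module.End.mul_apply, hBP _ (hBim v), LinearMap.zero_apply]
  have hCC : C * C = 0 := LinearMap.ext fun v => by
    rw [Module.End.mul_apply, hCQ _ (hCim v), LinearMap.zero_apply]
  obtain ⟨E, hE⟩ : ∃ E : Module.End ℂ (ℂ ⊗[ℚ] V), E = t⁻¹ • (B * C) := ⟨_, rfl⟩
  obtain ⟨F, hF⟩ : ∃ F : Module.End ℂ (ℂ ⊗[ℚ] V), F = t⁻¹ • (C * B) := ⟨_, rfl⟩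
  rw [← hE, ← hF] at hy1 hEyF
  obtain ⟨hEE, hFF, hEB, hBF, hFC, hCE, hBE, hFB, hEF, hFE⟩ := WeightOnePeirce.tripotent_facts ht hBCB hCBC hBB hCC hE hF
  have hFP : ∀ p ∈ H.piece 1 0, F p = 0 := fun p hp => by
    rw [hF, LinearMap.smul_apply, Module.End.mul_apply, hBP p hp, map_zero, smul_zero]
  have hPQ : ∀ v : ℂ ⊗[ℚ] V, (2 : ℂ)⁻¹ • (v + Θ v) + (2 : ℂ)⁻¹ • (v - Θ v) = v := fun v => by module
  -- `x = B + y` is raising, in `𝔊`, non-zero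
  have hx𝔊 : B + y ∈ 𝔊 := Submodule.add_mem _ hB hy
  have hxP : ∀ p ∈ H.piece 1 0, (B + y) p = 0 := fun p hp => by rw [LinearMap.add_apply, hBP p hp, hyP p hp, add_zero]
  have hxim : ∀ v, (B + y) v ∈ H.piece 1 0 := fun v => Submodule.add_mem _ (hBim v) (hyim v)
  have hx0 : B + y ≠ 0 := by
    intro h0
    have hyB : y = -B := eq_neg_of_add_eq_zero_right h0
    have e : E * (-B) * F = -B := by
      rw [show E * (-B) = -(E * B) from mul_neg E B, hEB, show (-B) * F = -(B * F) from neg_mul B F, hBF]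
    rw [hyB, e, neg_eq_zero] at hEyF
    exact hB0 hEyF
  have hge := hmin _ hx𝔊 hx0 hxP hxim
  -- `range (B + y) ≤ range ((B + y) * F)`
  have hEa : ∀ v, E (E (y v)) = E (y v) := fun v => by rw [← Module.End.mul_apply E E, hEE]
  have hkey : ∀ q, E (y q) ∈ LinearMap.range ((B + y) * F) := fun q => by
    -- `w = t⁻¹ C (E y q) ∈ range F` and `(B + y) w = E y q`
    have hw : t⁻¹ • C (E (y q)) = F (t⁻¹ • C (E (y q))) := by
      -- `C (E y q) = C B v₁` with `E y q = t⁻¹ B C (y q)`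
      rw [hE, LinearMap.smul_apply, Module.End.mul_apply, map_smul, map_smul, map_smul,
        show C (B (C (y q))) = (C * B) (C (y q)) from rfl, ← Module.End.mul_apply F (C * B),
        show F * (C * B) = C * B by rw [hF, smul_mul_assoc, show C * B * (C * B) = C * (B * C * B) by simp only [mul_assoc],
          hBCB, mul_smul_comm, smul_smul, inv_mul_cancel₀ ht, one_smul]]
    refine ⟨t⁻¹ • C (E (y q)), ?_⟩
    rw [Module.End.mul_apply, ← hw, map_smul, LinearMap.add_apply]
    -- `B (C (E y q)) = t E (E y q) = t E y q` and `y (C (E y q)) = (y C y)-term = 0`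
    have h1 : B (C (E (y q))) = t • E (y q) := by
      rw [← hEa q, show B (C (E (E (y q)))) = (B * C) (E (E (y q))) from rfl,
        show B * C = t • E by rw [hE, smul_smul, mul_inv_cancel₀ ht, one_smul], LinearMap.smul_apply, hEa, hEa]
    have h2 : y (C (E (y q))) = 0 := by
      -- `E y q = y q - y F q`, `C (y F q) = 0`, and `y C y = 0`
      have hsplit : E (y q) = y q - y (F q) := by
        have h := LinearMap.congr_fun hy1 q
        rw [LinearMap.add_apply, Module.End.mul_apply, Module.End.mul_apply] at h
        exact eq_sub_of_add_eq h
      have hCyF : C (y (F q)) = 0 := by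
        have h1 : E (y (F q)) = 0 := by
          rw [← Module.End.mul_apply, ← Module.End.mul_apply, show E * y * F = 0 from hEyF, LinearMap.zero_apply]
        rw [← hCE, Module.End.mul_apply, h1, map_zero]
      rw [hsplit, map_sub, hCyF, sub_zero, ← Module.End.mul_apply, ← Module.End.mul_apply, hyCy, LinearMap.zero_apply]
    rw [smul_add, h1, h2, smul_zero, add_zero, smul_smul, inv_mul_cancel₀ ht, one_smul]
  have hle : LinearMap.range (B + y) ≤ LinearMap.range ((B + y) * F) := by
    rintro _ ⟨v, rfl⟩
    -- `v = p + F v' + (1 - F) q`-type decomposition: `(B + y) v = (B + y) (F v) + E y ((1 - F)-part)`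
    have hv : (B + y) v = ((B + y) * F) v + E (y (v - F v)) := by
      -- compute directly: `(B + y) v - (B + y)(F v) = B (v - F v) + y (v - F v)`, `B (v - F v) = 0`, `y (v - F v) = E y (v - F v)`
      have hB1 : B (v - F v) = 0 := by
        rw [map_sub, ← Module.End.mul_apply B F, hBF, sub_self]
      have hyF1 : y (F (v - F v)) = 0 := by
        rw [map_sub, ← Module.End.mul_apply F F, hFF, sub_self, map_zero]
      have hy2 : y (v - F v) = E (y (v - F v)) := by
        have h := LinearMap.congr_fun hy1 (v - F v)
        rw [LinearMap.add_apply, Module.End.mul_apply, Module.End.mul_apply, hyF1, add_zero] at h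
        exact h.symm
      rw [Module.End.mul_apply, LinearMap.add_apply, LinearMap.add_apply]
      have e : B v + y v = (B (F v) + y (F v)) + (B (v - F v) + y (v - F v)) := by
        rw [map_sub, map_sub]; abel
      rw [e, hB1, zero_add, hy2, hEa]
    rw [hv]
    exact Submodule.add_mem _ (LinearMap.mem_range_self _ v) (hkey _)
  -- dimension count
  have h1 : Module.finrank ℂ (LinearMap.range ((B + y) * F)) ≤ Module.finrank ℂ (LinearMap.range F) := by
    rw [Module.End.mul_eq_comp, LinearMap.range_comp]
    exact Submodule.finrank_map_le _ _
  have h2 : Module.finrank ℂ (LinearMap.range F) ≤ Module.finrank ℂ (LinearMap.range B) := by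
    rw [hF, LinearMap.range_smul _ _ (inv_ne_zero ht), Module.End.mul_eq_comp, LinearMap.range_comp]
    exact Submodule.finrank_map_le _ _
  have h3 := Submodule.finrank_mono hle
  omega


set_option maxHeartbeats 1600000 in
/-- **Every raising element with a non-zero Peirce-`2` component has rank `rank B`** (`2 · rank B > dim V^{1,0}`): by N7
`x = s B + x₁` with `x₁` Peirce-`1` and `s ≠ 0`, and `rank (B + s⁻¹ x₁) = rank B` by `finrank_range_add_peirceOne`.
[cite: MoonenZarhin1999LowDim, §2 (2.3)–(2.5)] [cite: Deligne1982HodgeCycles, I §3 Prop. 3.4, Prop. 3.6] -/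
theorem WeightOnePeirce.finrank_range_eq_of_peirceTwo_ne_zero (H : HodgeStructure V n) (ψ : H.Polarization) (hn : n = 1)
    (heff : H.IsEffective) {Θ : Module.End ℂ (ℂ ⊗[ℚ] V)} (hΘ : ∀ p, ∀ x ∈ H.piece p (n - p), Θ x = ((2 * p - n : ℤ) : ℂ) • x)
    {𝔊 : Submodule ℂ (Module.End ℂ (ℂ ⊗[ℚ] V))} (h𝔊 : 𝔊 ≤ H.hodgeLieC) (hbr : ∀ Y ∈ 𝔊, ∀ Z ∈ 𝔊, Y * Z - Z * Y ∈ 𝔊)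
    {B C : Module.End ℂ (ℂ ⊗[ℚ] V)} (hB : B ∈ 𝔊) (hB0 : B ≠ 0) (hBP : ∀ p ∈ H.piece 1 0, B p = 0)
    (hBim : ∀ v, B v ∈ H.piece 1 0) (hC : ∀ v, C v = conj (B (conj v))) (hC𝔊 : C ∈ 𝔊)
    (hmin : ∀ B' ∈ 𝔊, B' ≠ 0 → (∀ p ∈ H.piece 1 0, B' p = 0) → (∀ v, B' v ∈ H.piece 1 0) →
      Module.finrank ℂ (LinearMap.range B) ≤ Module.finrank ℂ (LinearMap.range B'))
    {t : ℂ} (ht : t ≠ 0) (hBCB : B * C * B = t • B)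
    (h2r : Module.finrank ℂ (H.piece 1 0) < 2 * Module.finrank ℂ (LinearMap.range B))
    {x : Module.End ℂ (ℂ ⊗[ℚ] V)} (hx : x ∈ 𝔊) (hxP : ∀ p ∈ H.piece 1 0, x p = 0) (hxim : ∀ v, x v ∈ H.piece 1 0)
    (hx2 : t⁻¹ • (B * C) * x * (t⁻¹ • (C * B)) ≠ 0) :
    Module.finrank ℂ (LinearMap.range x) = Module.finrank ℂ (LinearMap.range B) := by
  classical
  obtain ⟨s, hs⟩ := WeightOnePeirce.eq_smul_add_peirceOne H ψ hn heff hΘ h𝔊 hbr hB hB0 hBP hBim hC hC𝔊 hmin ht hBCB h2r hx hxP hxim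
  obtain ⟨hCBC, -⟩ := WeightOnePeirce.conjOp_mul_conjOp_mul hC ht hB0 hBCB
  have hBB : B * B = 0 := LinearMap.ext fun v => by
    rw [Module.End.mul_apply, hBP _ (hBim v), LinearMap.zero_apply]
  have hCC : C * C = 0 := LinearMap.ext fun v => by
    subst hn
    obtain ⟨hCQ, hCim, -, -⟩ := SymplecticThetaTen.conjOp_raise (P := H.piece 1 0) (Q := H.piece 0 1)
      (fun x hx => conj_mem_piece H hx) (fun x hx => conj_mem_piece H hx) hBP hBim hC
    rw [Module.End.mul_apply, hCQ _ (hCim v), LinearMap.zero_apply]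
  obtain ⟨E, hE⟩ : ∃ E : Module.End ℂ (ℂ ⊗[ℚ] V), E = t⁻¹ • (B * C) := ⟨_, rfl⟩
  obtain ⟨F, hF⟩ : ∃ F : Module.End ℂ (ℂ ⊗[ℚ] V), F = t⁻¹ • (C * B) := ⟨_, rfl⟩
  rw [← hE, ← hF] at hs hx2
  obtain ⟨hEE, hFF, hEB, hBF, -, -, -, -, -, -⟩ := WeightOnePeirce.tripotent_facts ht hBCB hCBC hBB hCC hE hF
  have hxB : x * B = 0 := LinearMap.ext fun v => by
    rw [Module.End.mul_apply, hxP _ (hBim v), LinearMap.zero_apply]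
  have hBx : B * x = 0 := LinearMap.ext fun v => by
    rw [Module.End.mul_apply, hBP _ (hxim v), LinearMap.zero_apply]
  obtain ⟨-, hx1mem⟩ := WeightOnePeirce.peirceOne_mem hbr ht hBCB hCBC hBB hCC hE hF hB hC𝔊 hx hxB hBx
  -- the Peirce-1 component `x₁` and its idempotence
  obtain ⟨x₁, hx₁⟩ : ∃ x₁ : Module.End ℂ (ℂ ⊗[ℚ] V), x₁ = E * x + x * F - (2 : ℂ) • (E * x * F) := ⟨_, rfl⟩
  rw [← hx₁] at hs hx1mem
  have h1 : E * x₁ = E * x - E * x * F := by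
    rw [hx₁, mul_sub, mul_add, mul_smul_comm, ← mul_assoc E E x, hEE, ← mul_assoc E x F, ← mul_assoc E (E * x) F,
      ← mul_assoc E E x, hEE, two_smul]
    abel
  have h2 : x₁ * F = x * F - E * x * F := by
    rw [hx₁, sub_mul, add_mul, smul_mul_assoc, mul_assoc x F F, hFF, mul_assoc (E * x) F F, hFF, two_smul]
    abel
  have h3 : E * x₁ * F = 0 := by rw [h1, sub_mul, mul_assoc (E * x) F F, hFF, sub_self]
  have h4 : E * x₁ + x₁ * F = x₁ := by rw [h1, h2, hx₁, two_smul]; abel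
  -- `s ≠ 0` since the Peirce-2 component of `x` is `s B`
  have hs0 : s ≠ 0 := by
    intro h0
    rw [h0, zero_smul, zero_add] at hs
    apply hx2
    rw [hs, h3]
  -- `y = s⁻¹ x₁` is Peirce-1 and `x = s (B + y)`
  have hy𝔊 : s⁻¹ • x₁ ∈ 𝔊 := Submodule.smul_mem _ _ hx1mem
  have hyP : ∀ p ∈ H.piece 1 0, (s⁻¹ • x₁) p = 0 := fun p hp => by
    subst hn
    have hFP : F p = 0 := by rw [hF, LinearMap.smul_apply, Module.End.mul_apply, hBP p hp, map_zero, smul_zero]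
    rw [LinearMap.smul_apply, hx₁]
    simp only [LinearMap.sub_apply, LinearMap.add_apply, LinearMap.smul_apply, Module.End.mul_apply, hFP, hxP p hp, map_zero,
      smul_zero, add_zero, sub_zero]
  have hyim : ∀ v, (s⁻¹ • x₁) v ∈ H.piece 1 0 := fun v => by
    have hEP : ∀ w, E w ∈ H.piece 1 0 := fun w => by
      rw [hE, LinearMap.smul_apply, Module.End.mul_apply]
      exact Submodule.smul_mem _ _ (hBim _)
    rw [LinearMap.smul_apply, hx₁]
    simp only [LinearMap.sub_apply, LinearMap.add_apply, LinearMap.smul_apply, Module.End.mul_apply]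
    exact Submodule.smul_mem _ _ (Submodule.sub_mem _ (Submodule.add_mem _ (hEP _) (hxim _)) (Submodule.smul_mem _ _ (hEP _)))
  have hy1 : E * (s⁻¹ • x₁) + (s⁻¹ • x₁) * F = s⁻¹ • x₁ := by
    rw [mul_smul_comm, smul_mul_assoc, ← smul_add, h4]
  have hEyF : E * (s⁻¹ • x₁) * F = 0 := by rw [mul_smul_comm, smul_mul_assoc, h3, smul_zero]
  have hrk := WeightOnePeirce.finrank_range_add_peirceOne H ψ hn heff hΘ h𝔊 hbr hB hB0 hBP hBim hC hC𝔊 hmin ht hBCB h2r hy𝔊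
    hyP hyim (by rw [← hE, ← hF]; exact hy1) (by rw [← hE, ← hF]; exact hEyF)
  have hxs : x = s • (B + s⁻¹ • x₁) := by rw [smul_add, smul_smul, mul_inv_cancel₀ hs0, one_smul]; exact hs
  rw [hxs, LinearMap.range_smul _ _ hs0, hrk]

end HodgeStructure

end Literature.AlgebraicGeometry.Motives
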